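import Mathlib.Data.ZMod.Basic
import Mathlib.Algebra.Module.Basic
import Mathlib.Tactic
import HarnessLib

/-!
# Route `GreenTaoLevelTwo`, crux `GITwo` (stmt-Parity-21275), line `birth`, stub `stub_cyclicInverse`:
# iterating a locally additive map (bookkeeping for GT08a arXiv Lemma 38)

Twenty-sixth helper file toward the XL stub `stub_cyclicInverse` (B. Green, T. Tao, *An inverse
theorem for the Gowers `U³(G)` norm*, arXiv:math/0503014, Thm. 68 = PEMS 51 (2008) Thm. 12.8).
arXiv Lemma 38 (generalized Fourier decay, block B7) concerns a phase `φ` which is LOCALLY LINEAR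
on a Bohr set `B = B(S,ρ)`: `φ(x+y) = φ(x) + φ(y)` whenever `x, y ∈ B`; its proof uses "by local
linearity `φ(x+ny) = φ(x) + nφ(y)` for all `|n| ≤ M`", which is exact when the multiples `jy`,
`|j| ≤ M`, stay in `B`.  This def-free file lands that bookkeeping for an arbitrary finset `B`
(symmetric and containing the relevant multiples) and an arbitrary abelian target group (the
paper's `ℝ/ℤ`, or `ℤ/Nℤ` for the frequency map `μ` of arXiv Prop. 43, `…LocalHomBohr`):

* `map_zero_of_locAdd`, `map_neg_of_locAdd` — `φ 0 = 0`, `φ(−z) = −φ(z)` (`0, z, −z ∈ B`);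
* `map_nsmul_of_locAdd` — `φ(n•y) = n•φ(y)` for `n ≤ M` when `j•y ∈ B` for all `j ≤ M`;
* `map_add_nsmul_of_locAdd`, `map_sub_nsmul_of_locAdd` — `φ(x ± n•y) = φ(x) ± n•φ(y)` for `x ∈ B`,
  `n ≤ M`, `B` symmetric.

References: [GreenTao2008U3Inverse] arXiv:math/0503014, Lemma 38 (proof).
-/

namespace Summit.Parity.GeneralizedHardyLittlewood.GreenTaoLevelTwoGITwoCyclicInverse

variable {N : ℕ} {A : Type*} [AddCommGroup A] {B : Finset (ZMod N)} {φ : ZMod N → A}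

/-- A locally additive map vanishes at `0 ∈ B`. [folklore] -/
theorem map_zero_of_locAdd (hloc : ∀ x ∈ B, ∀ y ∈ B, φ (x + y) = φ x + φ y) (h0 : (0 : ZMod N) ∈ B) :
    φ 0 = 0 := by
  have h := hloc 0 h0 0 h0
  rw [add_zero] at h
  -- in an additive group, `a = a + a` forces `a = 0`
  have h' : φ 0 + φ 0 = φ 0 + 0 := by rw [add_zero]; exact h.symm
  exact add_left_cancel h'

/-- A locally additive map is odd on `B ∩ (−B)`. [folklore] -/
theorem map_neg_of_locAdd (hloc : ∀ x ∈ B, ∀ y ∈ B, φ (x + y) = φ x + φ y) (h0 : (0 : ZMod N) ∈ B)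
    {z : ZMod N} (hz : z ∈ B) (hnz : -z ∈ B) : φ (-z) = -φ z := by
  have h := hloc z hz (-z) hnz
  rw [add_neg_cancel, map_zero_of_locAdd hloc h0] at h
  exact (neg_eq_of_add_eq_zero_right h.symm).symm

/-- `φ(n•y) = n•φ(y)` for `n ≤ M` when all multiples `j•y`, `j ≤ M`, lie in `B`.
[cite: GreenTao2008U3Inverse, Lemma 38 (proof)] -/
theorem map_nsmul_of_locAdd (hloc : ∀ x ∈ B, ∀ y ∈ B, φ (x + y) = φ x + φ y) {y : ZMod N} {M : ℕ}
    (hy : ∀ j : ℕ, j ≤ M → j • y ∈ B) : ∀ n : ℕ, n ≤ M → φ (n • y) = n • φ y := by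
  intro n
  induction n with
  | zero =>
    intro _
    have h0 : (0 : ZMod N) ∈ B := by simpa using hy 0 (Nat.zero_le M)
    rw [zero_smul, zero_smul, map_zero_of_locAdd hloc h0]
  | succ n ih =>
    intro hn
    have h1 : y ∈ B := by simpa using hy 1 (by omega)
    rw [succ_nsmul, hloc (n • y) (hy n (by omega)) y h1, ih (by omega), succ_nsmul]

/-- `φ(x + n•y) = φ(x) + n•φ(y)` for `x ∈ B`, `n ≤ M`, when the multiples `j•y` (`j ≤ M`) lie in
`B`. [cite: GreenTao2008U3Inverse, Lemma 38 (proof)] -/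
theorem map_add_nsmul_of_locAdd (hloc : ∀ x ∈ B, ∀ y ∈ B, φ (x + y) = φ x + φ y) {x y : ZMod N}
    (hx : x ∈ B) {M : ℕ} (hy : ∀ j : ℕ, j ≤ M → j • y ∈ B) {n : ℕ} (hn : n ≤ M) :
    φ (x + n • y) = φ x + n • φ y := by
  rw [hloc x hx (n • y) (hy n hn), map_nsmul_of_locAdd hloc hy n hn]

/-- `φ(x − n•y) = φ(x) − n•φ(y)` for `x ∈ B`, `n ≤ M`, when `B` is symmetric and the multiples
`j•y` (`j ≤ M`) lie in `B`. [cite: GreenTao2008U3Inverse, Lemma 38 (proof)] -/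
theorem map_sub_nsmul_of_locAdd (hloc : ∀ x ∈ B, ∀ y ∈ B, φ (x + y) = φ x + φ y)
    (hsymm : ∀ z ∈ B, -z ∈ B) {x y : ZMod N} (hx : x ∈ B) {M : ℕ}
    (hy : ∀ j : ℕ, j ≤ M → j • y ∈ B) {n : ℕ} (hn : n ≤ M) :
    φ (x - n • y) = φ x - n • φ y := by
  have h0 : (0 : ZMod N) ∈ B := by simpa using hy 0 (Nat.zero_le M)
  rw [sub_eq_add_neg, hloc x hx (-(n • y)) (hsymm _ (hy n hn)),
    map_neg_of_locAdd hloc h0 (hy n hn) (hsymm _ (hy n hn)), map_nsmul_of_locAdd hloc hy n hn,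
    sub_eq_add_neg]

end Summit.Parity.GeneralizedHardyLittlewood.GreenTaoLevelTwoGITwoCyclicInverse
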